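import Literature.Analysis.FluidPDE.ElgindiAprioriTransfer
import HarnessLib

/-!
# Solvability of Elgindi's polar problem with `𝓗⁴` a-priori bounds for smooth orthogonal data
([Elgindi2021] Proposition 7.1, Proposition 7.7, Theorem 2)

Topic `Literature/Analysis/FluidPDE`. Proof file (everything proved, no definitions, no named
facts) on the proof path of the named fact
`Literature.Analysis.FluidPDE.Elgindi.ElgindiGhoulMasmoudi2021_stabilityCore`
(`ElgindiStabilityDecomposition.lean`). T. M. Elgindi, Ann. of Math. 194 (2021) =
arXiv:1904.04795, §7.1 Proposition 7.1 (p. 19), §7.3 Proposition 7.7 (p. 21), Theorem 2 (p. 8).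

**The linear theorem.** For `0 < α ≤ 1/4` and every smooth datum `f` compactly supported inside
`R > 0` and orthogonal to `K(θ) = 3 sin θ cos²θ` (against all `n(R)K(θ)`), there is a solution
`Ψ ∈ C^∞(strip)` of `L_αΨ = f` which generates a tangential family (all `D_R^kΨ` have finite
tangential and Hardy energies, `Ψ` and its derivatives extend to the closed strip with
`Ψ = cos θ·χ̃`, `χ̃ ∈ C^∞` after radial cut-off), is orthogonal to `K` slice-wise, and obeys the
a-priori estimate `|∂_θθΨ|²_{𝓗⁴} + |αD_RΨ|²_{𝓗⁴} + |α²D_R²Ψ|²_{𝓗⁴} ≤ 6C₀|f|²_{𝓗⁴}`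
(`linear_solvability`). This assembles the Lax–Milgram solution, its interior and boundary
regularity and the transfer of the a-priori estimate.
-/

noncomputable section

open MeasureTheory Set Real Filter Function
open _root_.Topology
open scoped ENNReal InnerProductSpace ContDiff

namespace Literature.Analysis.FluidPDE

namespace Elgindi

/-- **Existence of the solution data** for a smooth orthogonal datum. [folklore] -/
theorem exists_solData {α : ℝ} (hα : 0 < α) (hα4 : α ≤ 1 / 4) {f : ℝ → ℝ → ℝ} (hfn : ∀ n : ℕ, ContDiff ℝ n (uncurry f))
    (hfs : HasCompactSupport (uncurry f)) (hfpos : ∀ p ∈ tsupport (uncurry f), 0 < p.1)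
    (HF : ∀ n : ℝ → ℝ, Continuous n → HasCompactSupport n → ∫ p in strip, f p.1 p.2 * (n p.1 * kernelK p.2) = 0) :
    ∃ (U : ℕ → E4) (Ψ : ℝ × ℝ → ℝ), SolData α f U Ψ := by
  have hα1 : α ≤ 1 := hα4.trans (by norm_num)
  choose U hU using fun j => IsWeakSol.exists_of hα hα1 (toL2 fun p : ℝ × ℝ => (Dz^[j] f) p.1 p.2)
  have hfc : Continuous (uncurry f) := (hfn 0).continuous
  have hf' : ContDiffOn ℝ ∞ (uncurry f) strip := (contDiff_infty.2 hfn).contDiffOn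
  have HF' : ∀ n : ℝ → ℝ, Continuous n → HasCompactSupport n → ∫ p in strip, uncurry f p * (n p.1 * kernelK p.2) = 0 := HF
  have hU0 := hU 0
  have e0 : (toL2 fun p : ℝ × ℝ => (Dz^[0] f) p.1 p.2) = toL2 (uncurry f) := by congr 1
  rw [e0] at hU0
  obtain ⟨Ψ, hΨ, hae⟩ := exists_smooth_rep hα hfc hfs hf' HF' hU0.mem hU0.eq
  exact ⟨U, Ψ, ⟨hα, hα4, hfn, hfs, hfpos, HF, hU, hΨ, hae⟩⟩

/-- **Solvability with a-priori bounds (Elgindi 2021, Propositions 7.1/7.7, Theorem 2, for smooth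
orthogonal data).** [cite: Elgindi2021, §7.1 Proposition 7.1 (p. 19), §7.3 Proposition 7.7 (p. 21), Theorem 2 (p. 8 of arXiv:1904.04795)] -/
theorem linear_solvability {α : ℝ} (hα : 0 < α) (hα4 : α ≤ 1 / 4) {f : ℝ → ℝ → ℝ} (hfn : ∀ n : ℕ, ContDiff ℝ n (uncurry f))
    (hfs : HasCompactSupport (uncurry f)) (hfpos : ∀ p ∈ tsupport (uncurry f), 0 < p.1)
    (HF : ∀ n : ℝ → ℝ, Continuous n → HasCompactSupport n → ∫ p in strip, f p.1 p.2 * (n p.1 * kernelK p.2) = 0) :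
    ∃ Ψ : ℝ → ℝ → ℝ, TangentialFamily α f Ψ ∧ (∀ p ∈ strip, ellipticOp α Ψ p.1 p.2 = f p.1 p.2) ∧
      (∀ j : ℕ, ∀ R, 0 < R → kMoment (Dz^[j] Ψ) R = 0) ∧
      lhsA α Ψ ≤ 6 * aprioriC * eHkNormSq α 4 f := by
  obtain ⟨U, Ψ, hS⟩ := exists_solData hα hα4 hfn hfs hfpos HF
  refine ⟨fun R θ => Ψ (R, θ), (tangentialFamily hS.pos hS.le1 hS.fn hS.fs hS.forth hS.sol hS.smooth hS.ae), fun p hp => ?_, fun j R hR => hS.kMoment_iterate_eq_zero j hR, hS.apriori_solution⟩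
  have := (tangentialFamily hS.pos hS.le1 hS.fn hS.fs hS.forth hS.sol hS.smooth hS.ae).eqn 0 p hp
  simpa using this

end Elgindi

end Literature.Analysis.FluidPDE
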